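import Summits.QuantumFields.BalabanUV.Beta.GAN24.WardResidualRotatedVertexInversion
import Summits.QuantumFields.BalabanUV.Beta.AxialDressingRootedBmKernel
import Summits.QuantumFields.BalabanUV.Beta.AxialDressingRootedBmHessian

/-!
# `BalabanUV.Beta.GAN24.CoDressedColumnPointInversion` — binder row G-an2-4 ∕ (CONV-C), the (S) row of RULING R-gan24p1-g27-1 PART B (viii), sub-step
# (INV-X) ∕ (INV-G): **THE POINT-INVERSION COVARIANCE OF THE CO-DRESSED STEP RESOLVENT's COLUMNS AT THE CENTRED ROOT** — the displayed hypotheses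
# `hGH` ∕ `hGM` of road-P2's `WardResidualRotatedVertexInversion.weightedProfile_comb_slotInv` DISCHARGED with signs `s = s′ = 1` (`Lc` odd, root = block centre)

NOT IN PRINT; OUR BOOKKEEPING ([folklore] `d + 1` rewrites by an2's axis-reflection invariance `AxialDressingRooted.refK_coDressKBmAt_KInvStep` — iterated over a
finite set of axes WITHOUT any composition of leg maps (asym1 g115 W2: `KernelReflection.LegMap` has no `trans`) — and one block translation
`AxialDressingRooted.shiftK_coDressKBmAt_KInvStep`; 0 `def`, 0 cited fact, 0 `def … : Prop`, 0 sorry).  The OWNER gan24-p1 g28's RULING R-gan24p1-g28-1 (v) named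
exactly this route («`refK_coDressKBmAt_KInvStep` iterated over the d+1 axes at the centred root (+ `shiftK_coDressKBmAt_KInvStep` for the label translation)
produces `hGH ∕ hGM`»); road-P2 g39's engine E26 observed `s = s′ = +1` on SDF-1.  HONEST FRAMING (cell contract, verbatim): «discharging `BetaPertH` makes
Bałaban's UV stability UNCONDITIONAL — a real constructive-QFT result; it is NOT the continuum limit and NOT the Clay problem.»  HONEST DEPENDENCY (verbatim):
«continuum YM on T⁴ ⇐ BetaPertH ∧ nine spine estimates (0/9 proved); BetaPertH ⇐ (D1) ∧ (D4) ∧ CAP+tail; G-an2-4 gates asym, D1 and NE2/3/4.»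

WHAT.  `Φ N α` is lit-balaban's reflection leg map of axis `α` at blocking `N` (`ResolventReflection.Φ`: field legs `inl κ` moved by the bond base-point map
`bref α κ`, multiplier legs `inr κ` by `mref N α κ`, both signed by `reflSign α κ`); `refK (Φ N α) K = K` is reflection invariance of a packed kernel.
* §1 ONE AXIS MOVES ONE COORDINATE: `(Φ N α).r a x i = x i` for `i ≠ α`, and the `α`-coordinate of the image depends on `x α` only — for BOTH leg types.
* §2 **`refK_iterate`**: if `K` is `Φ N α`-invariant for every axis `α`, then for every finite set `s` of axes
  `K x z a b = (∏_{α∈s} s_a)·(∏_{α∈s} s_b)·K (R_s^a x) (R_s^b z) a b`, `R_s^a x := (i ↦ if i ∈ s then (Φ N i).r a x i else x i)` — induction on `s`, each step ONE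
  rewrite by `refK (Φ N α) K = K` at the already-reflected points (the reflections of distinct axes touch distinct coordinates, so no composition lemma is needed);
  `prod_legSign_univ` (`∏_α (Φ N α).s a = −1`: exactly one axis is the leg's own); **`refK_pointInv`** (`s = univ`: the TOTAL POINT INVERSION through `−½·𝟙`,
  `K (R^a x) (R^b z) a b = K x z a b`, the two signs `−1·−1` cancel); the closed forms `pointInv_inl` (`R^{inl κ} x = −𝟙 − x − e_κ`: a field bond goes to the
  inverted bond re-based at its far end) and `pointInv_inr_zsmul` (`R^{inr μ} (N•y) = N•(−𝟙 − y − e_μ)`: a multiplier leg = a coarse bond, likewise).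
* §3 THE CO-DRESSED STEP RESOLVENT AT THE CENTRED ROOT (`G_j := coDressKBmAt (toSite (ctrOff (d+1) Lc)) Lc (KInvStep Lc j)`, `Lc` odd, every `j`):
  **`coDress_pointInv_ctr`** — the total inversion followed by ANY block translation `Lc•T` leaves EVERY block of `G_j` invariant (§2 ⨾ an2's block-translation
  invariance); hence, for every integer vector `t` (inversion of the coarse slot bond through `t∕2`, of the fine legs through `(Lc•t + (Lc−1)•𝟙)∕2` — the same point):
  **`colH_pointInv_ctr_gen`** (`colH G_j Lc ν (t − e_ν − y′) κ (Lc•t + (Lc−1)•𝟙 − e_κ − u) = colH G_j Lc ν y′ κ u`), **`colM_pointInv_ctr_gen`**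
  (`colM G_j Lc ν (t − e_ν − y′) ρ (t − e_ρ − w) = colM G_j Lc ν y′ ρ w`), and at `t = 2•y` (`c_y := Lc•(2•y) + (Lc−1)•𝟙`) the two LITERAL hypotheses of road-P2's file
  with unit signs: **`colH_pointInv_ctr`**, **`colM_pointInv_ctr`**.  (General `t` serves the deeper classes `exit^{Lc·M}` of the charge tower: `t ≡ −𝟙 (mod M)`.)
* §4 THE CONSUMER RE-ISSUED AT THE CENTRED ROOT: **`weightedProfile_comb_slotInv_ctr`** and **`weightedCharge_rotatedVertex_slotInv_ctr`** — road-P2 g39's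
  `weightedProfile_comb_slotInv` ∕ `weightedCharge_rotatedVertex_slotInv` with (INV-G) DISCHARGED (`s = s′ = 1`), so that ONLY the table-charge covariance (INV-Z)
  `hZS ∕ hZM` (now with the single sign `ε = t = t′`) remains displayed: at the centred root, `Lc` odd, (INV-X-geo) holds modulo (INV-Z) alone.
WHAT THIS FILE DOES NOT DO.  (INV-Z) (an1's tables' ω-charges under the inversion — a CHARGE identity for the pure stencil per the OWNER's R-g28-1 (v), engine E22∕E23)
stays DISPLAYED; other in-block roots are NOT claimed (the comb rooted off-centre is not inversion-symmetric); nothing of (W-γ) ∕ (S) ∕ (Q-R) ∕ (LT) ∕ (Q-L) ∕ (C) ∕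
«T2Shape» ∕ «T2Drift» ∕ (hW, hWall) is discharged; asserts NO value of Bałaban's tables; NEVER «G-an2-4 closed» as (CONV-C); NOT D1, NOT `BetaPertH`, NOT continuum,
NOT Clay.  2026-08-22 (gan24-formalise-leaf-02 gen 58); no existing file touched.
-/

noncomputable section

open Finset
open scoped BigOperators
open Literature.MathematicalPhysics.QuantumFieldTheory
open Literature.MathematicalPhysics.QuantumFieldTheory.Balaban1983to89
open Literature.MathematicalPhysics.QuantumFieldTheory.Balaban1983to89.Beta
open ExpKernelCalculus (Site MKer shiftK)
open AffineAveraging (box toSite)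
open AveragingContours (blk)
open AveragingContoursRooted (ctrOff ctrOff_mem_box)
open PolarizationSign (reflSign)
open KernelReflection (LegMap refK refK_apply)
open ResolventReflection (bref bref_apply mref Φ Φ_r_inl Φ_r_inr Φ_s_inl Φ_s_inr)
open OneStepResolventKernel (Fib)
open OneStepKernelFamily (KInvStep colH)
open SecondOrderResponse (colM dM)
open Summit.QuantumFields.BalabanUV.Beta.BorderedHessian (diagK)
open Summit.QuantumFields.BalabanUV.Beta.ChartConjugation (conjV)
open Summit.QuantumFields.BalabanUV.Beta.AveragingWardRootedStencils (legInd)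
open Summit.QuantumFields.BalabanUV.Beta.AxialDressingRooted (coDressKBmAt refK_coDressKBmAt_KInvStep shiftK_coDressKBmAt_KInvStep)
open Summit.QuantumFields.BalabanUV.Beta.SpineRooted (SpureRecAt M1At)
open Summit.QuantumFields.BalabanUV.Beta.GAN24.WardResidualRotatedVertexInversion (weightedProfile_comb_slotInv weightedCharge_rotatedVertex_slotInv)

namespace Summit.QuantumFields.BalabanUV.Beta.GAN24.CoDressedColumnPointInversion

variable {d : ℕ}

/-! ## §1 One axis reflection moves one coordinate, for both leg types -/

/-- [folklore] The reflection leg map of axis `α` does not move the coordinates `i ≠ α` (field legs `bref`, multiplier legs `mref` alike). -/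
theorem legMap_r_apply_of_ne (N : ℕ) (α : Fin (d + 1)) (a : Fib d) (x : Site (d + 1)) {i : Fin (d + 1)} (hi : i ≠ α) :
    (Φ (d := d) N α).r a x i = x i := by
  cases a with
  | inl κ => rw [Φ_r_inl, bref_apply, if_neg hi]
  | inr κ => rw [Φ_r_inr]; simp [mref, hi]

/-- [folklore] … and the `α`-coordinate of the image depends on the `α`-coordinate of the argument only. -/
theorem legMap_r_apply_self_congr (N : ℕ) (α : Fin (d + 1)) (a : Fib d) {x x' : Site (d + 1)} (h : x α = x' α) :
    (Φ (d := d) N α).r a x α = (Φ (d := d) N α).r a x' α := by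
  cases a with
  | inl κ => rw [Φ_r_inl, Φ_r_inl, bref_apply, bref_apply, h]
  | inr κ => rw [Φ_r_inr, Φ_r_inr]; simp [mref, h]

/-! ## §2 Iterating the reflection invariance over a finite set of axes; the total point inversion -/

/-- [folklore] **ITERATED REFLECTION INVARIANCE, NO COMPOSITION OF LEG MAPS.**  If the packed kernel `K` is invariant under the reflection leg map of EVERY axis,
then for every finite set `s` of axes and all legs `(x, a)`, `(z, b)`:
`K x z a b = (∏_{α∈s} (Φ N α).s a)·(∏_{α∈s} (Φ N α).s b)·K (i ↦ [i ∈ s] ? (Φ N i).r a x i : x i) (i ↦ [i ∈ s] ? (Φ N i).r b z i : z i) a b`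
(induction on `s`: the reflections of distinct axes act on distinct coordinates, §1). -/
theorem refK_iterate {N : ℕ} {K : MKer (d + 1) (Fib d)} (hK : ∀ α : Fin (d + 1), refK (Φ N α) K = K) (s : Finset (Fin (d + 1)))
    (x z : Site (d + 1)) (a b : Fib d) :
    K x z a b = (∏ α ∈ s, (Φ (d := d) N α).s a) * (∏ α ∈ s, (Φ (d := d) N α).s b)
      * K (fun i => if i ∈ s then (Φ (d := d) N i).r a x i else x i) (fun i => if i ∈ s then (Φ (d := d) N i).r b z i else z i) a b := by
  classical
  induction s using Finset.induction_on with
  | empty => simp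
  | insert α s hα ih =>
    -- the already-reflected points
    set X : Site (d + 1) := fun i => if i ∈ s then (Φ (d := d) N i).r a x i else x i with hX
    set Z : Site (d + 1) := fun i => if i ∈ s then (Φ (d := d) N i).r b z i else z i with hZ
    -- one more reflection, in the axis `α ∉ s`
    have eX : (Φ (d := d) N α).r a X = fun i => if i ∈ insert α s then (Φ (d := d) N i).r a x i else x i := by
      funext i
      by_cases hi : i = α
      · subst hi
        rw [if_pos (Finset.mem_insert_self i s)]
        exact legMap_r_apply_self_congr N i a (by rw [hX]; simp [hα])
      · rw [legMap_r_apply_of_ne N α a X hi, hX]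
        simp [Finset.mem_insert, hi]
    have eZ : (Φ (d := d) N α).r b Z = fun i => if i ∈ insert α s then (Φ (d := d) N i).r b z i else z i := by
      funext i
      by_cases hi : i = α
      · subst hi
        rw [if_pos (Finset.mem_insert_self i s)]
        exact legMap_r_apply_self_congr N i b (by rw [hZ]; simp [hα])
      · rw [legMap_r_apply_of_ne N α b Z hi, hZ]
        simp [Finset.mem_insert, hi]
    have h1 : K X Z a b = (Φ (d := d) N α).s a * (Φ (d := d) N α).s b * K ((Φ (d := d) N α).r a X) ((Φ (d := d) N α).r b Z) a b := by
      have h := congrFun (congrFun (congrFun (congrFun (hK α) X) Z) a) b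
      rw [refK_apply] at h
      exact h.symm
    rw [ih, h1, eX, eZ, Finset.prod_insert hα, Finset.prod_insert hα]
    ring

/-- [folklore] The product of a leg's reflection signs over ALL axes is `−1`: exactly one axis is the leg's own direction. -/
theorem prod_legSign_univ (N : ℕ) (a : Fib d) : ∏ α : Fin (d + 1), (Φ (d := d) N α).s a = -1 := by
  cases a with
  | inl κ =>
    simp only [Φ_s_inl, reflSign]
    rw [Finset.prod_ite_eq]
    simp
  | inr κ =>
    simp only [Φ_s_inr, reflSign]
    rw [Finset.prod_ite_eq]
    simp

/-- [folklore] **THE TOTAL POINT INVERSION** (all `d + 1` axes; centre `−½·𝟙`): a packed kernel invariant under every axis reflection satisfies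
`K (i ↦ (Φ N i).r a x i) (i ↦ (Φ N i).r b z i) a b = K x z a b` — the two leg signs are both `−1` and cancel. -/
theorem refK_pointInv {N : ℕ} {K : MKer (d + 1) (Fib d)} (hK : ∀ α : Fin (d + 1), refK (Φ N α) K = K) (x z : Site (d + 1)) (a b : Fib d) :
    K (fun i => (Φ (d := d) N i).r a x i) (fun i => (Φ (d := d) N i).r b z i) a b = K x z a b := by
  have h := refK_iterate hK Finset.univ x z a b
  simp only [Finset.mem_univ, if_true] at h
  rw [h, prod_legSign_univ N a, prod_legSign_univ N b]
  ring

/-- [folklore] Closed form on a FIELD leg: the total inversion sends the bond `⟨x, x + e_κ⟩` to the bond based at `−𝟙 − x − e_κ` (the inverted bond, re-based at its far end). -/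
theorem pointInv_inl (N : ℕ) (κ : Fin (d + 1)) (x : Site (d + 1)) :
    (fun i => (Φ (d := d) N i).r (Sum.inl κ) x i) = fun i => -1 - x i - (Pi.single κ (1 : ℤ) : Site (d + 1)) i := by
  funext i
  rw [Φ_r_inl, bref_apply, if_pos rfl, Pi.single_apply]
  by_cases h : κ = i
  · subst h; simp
  · rw [if_neg h, if_neg (Ne.symm h)]

/-- [folklore] Closed form on a MULTIPLIER leg at a coarse point: the total inversion sends `N•y` to `N•(−𝟙 − y − e_μ)` (a multiplier leg is a coarse bond). -/
theorem pointInv_inr_zsmul (N : ℕ) (μ : Fin (d + 1)) (y : Site (d + 1)) :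
    (fun i => (Φ (d := d) N i).r (Sum.inr μ) ((N : ℤ) • y) i) = (N : ℤ) • (fun i => -1 - y i - (Pi.single μ (1 : ℤ) : Site (d + 1)) i) := by
  funext i
  rw [Φ_r_inr]
  simp only [mref, if_true, Pi.smul_apply, smul_eq_mul, Pi.single_apply]
  by_cases h : μ = i
  · subst h; simp; ring
  · rw [if_neg h, if_neg (Ne.symm h)]; ring

/-! ## §3 The co-dressed step resolvent at the centred root: inversion through the centre of any block -/

section Ctr

variable {Lc : ℕ} [NeZero Lc]

/-- NOT IN PRINT; OUR BOOKKEEPING.  **THE CO-DRESSED STEP RESOLVENT AT THE CENTRED ROOT IS INVARIANT UNDER THE POINT INVERSION THROUGH THE CENTRE OF ANY BLOCK**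
(`Lc` odd, every `j`, EVERY coarse translation `T`, every pair of legs): with `G_j := coDressKBmAt (toSite (ctrOff (d+1) Lc)) Lc (KInvStep Lc j)`,
`G_j (R^a x + Lc•T) (R^b z + Lc•T) a b = G_j x z a b` (§2 `refK_pointInv` over an2's `refK_coDressKBmAt_KInvStep`, then an2's block-translation invariance
`shiftK_coDressKBmAt_KInvStep`).  At `T = t + 𝟙`: `R^{inl κ} u + Lc•T = Lc•t + (Lc−1)•𝟙 − e_κ − u` and `R^{inr μ}(Lc•w) + Lc•T = Lc•(t − e_μ − w)`; road-P2's label-`y`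
inversion is `t = 2•y` (`c_y = Lc•(2•y) + (Lc−1)•𝟙`). -/
theorem coDress_pointInv_ctr (hLc : Odd Lc) (j : ℕ) (T x z : Site (d + 1)) (a b : Fib d) :
    coDressKBmAt (toSite (ctrOff (d + 1) Lc)) Lc (KInvStep (d := d) Lc j)
        ((fun i => (Φ (d := d) Lc i).r a x i) + (Lc : ℤ) • T) ((fun i => (Φ (d := d) Lc i).r b z i) + (Lc : ℤ) • T) a b
      = coDressKBmAt (toSite (ctrOff (d + 1) Lc)) Lc (KInvStep (d := d) Lc j) x z a b := by
  rw [← refK_pointInv (fun α => refK_coDressKBmAt_KInvStep (d := d) hLc j α) x z a b]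
  have hs := shiftK_coDressKBmAt_KInvStep (d := d) (Lc := Lc) (toSite (ctrOff (d + 1) Lc)) j (-T)
  have h := congrFun (congrFun (congrFun (congrFun hs (fun i => (Φ (d := d) Lc i).r a x i)) (fun i => (Φ (d := d) Lc i).r b z i)) a) b
  rw [← h]
  simp only [shiftK, smul_neg, neg_neg]

/-- NOT IN PRINT; OUR BOOKKEEPING.  **(INV-G), FIELD COLUMNS, GENERAL CENTRE** (centred root, `Lc` odd, every `j`, EVERY integer vector `t`, slot `(ν, y′)`, field leg `(κ, u)`):
`colH G_j Lc ν (t − e_ν − y′) κ (Lc•t + (Lc−1)•𝟙 − e_κ − u) = colH G_j Lc ν y′ κ u` — the inversion of the coarse slot bond through `t∕2` and of the fine leg bond through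
`(Lc•t + (Lc−1)•𝟙)∕2` (the same point of space); `t = 2•y` is road-P2's `hGH`, and `t ≡ −𝟙 (mod M)` serves the deeper classes `exit^{Lc·M}` of the charge tower. -/
theorem colH_pointInv_ctr_gen (hLc : Odd Lc) (j : ℕ) (t : Site (d + 1)) (ν : Fin (d + 1)) (y' : Site (d + 1)) (κ : Fin (d + 1)) (u : Site (d + 1)) :
    colH (coDressKBmAt (toSite (ctrOff (d + 1) Lc)) Lc (KInvStep (d := d) Lc j)) Lc ν (t - Pi.single ν 1 - y') κ
        ((Lc : ℤ) • t + toSite (fun _ : Fin (d + 1) => Lc - 1) - Pi.single κ 1 - u)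
      = colH (coDressKBmAt (toSite (ctrOff (d + 1) Lc)) Lc (KInvStep (d := d) Lc j)) Lc ν y' κ u := by
  have hLc1 : 1 ≤ Lc := hLc.pos
  simp only [colH]
  rw [← coDress_pointInv_ctr hLc j (t + fun _ => (1 : ℤ)) u ((Lc : ℤ) • y') (Sum.inl κ) (Sum.inr ν), pointInv_inl, pointInv_inr_zsmul]
  congr 1
  · funext i
    simp only [Pi.add_apply, Pi.sub_apply, Pi.smul_apply, smul_eq_mul, toSite, Nat.cast_sub hLc1, Nat.cast_one, Pi.single_apply]
    ring
  · funext i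
    simp only [Pi.add_apply, Pi.sub_apply, Pi.smul_apply, smul_eq_mul, Pi.single_apply]
    ring

/-- NOT IN PRINT; OUR BOOKKEEPING.  **(INV-G), MULTIPLIER COLUMNS, GENERAL CENTRE** (centred root, `Lc` odd, every `j`, every integer vector `t`):
`colM G_j Lc ν (t − e_ν − y′) ρ (t − e_ρ − w) = colM G_j Lc ν y′ ρ w`. -/
theorem colM_pointInv_ctr_gen (hLc : Odd Lc) (j : ℕ) (t : Site (d + 1)) (ν : Fin (d + 1)) (y' : Site (d + 1)) (ρ : Fin (d + 1)) (w : Site (d + 1)) :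
    colM (coDressKBmAt (toSite (ctrOff (d + 1) Lc)) Lc (KInvStep (d := d) Lc j)) Lc ν (t - Pi.single ν 1 - y') ρ (t - Pi.single ρ 1 - w)
      = colM (coDressKBmAt (toSite (ctrOff (d + 1) Lc)) Lc (KInvStep (d := d) Lc j)) Lc ν y' ρ w := by
  simp only [colM]
  rw [← coDress_pointInv_ctr hLc j (t + fun _ => (1 : ℤ)) ((Lc : ℤ) • w) ((Lc : ℤ) • y') (Sum.inr ρ) (Sum.inr ν), pointInv_inr_zsmul, pointInv_inr_zsmul]
  congr 1
  · funext i
    simp only [Pi.add_apply, Pi.sub_apply, Pi.smul_apply, smul_eq_mul, Pi.single_apply]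
    ring
  · funext i
    simp only [Pi.add_apply, Pi.sub_apply, Pi.smul_apply, smul_eq_mul, Pi.single_apply]
    ring

/-- NOT IN PRINT; OUR BOOKKEEPING.  **(INV-G), FIELD COLUMNS — the hypothesis `hGH` of road-P2's `weightedProfile_comb_slotInv` DISCHARGED with `s = 1`** (centred root, `Lc`
odd, every `j`, every label `y`, slot `(ν, y′)`, field leg `(κ, u)`):
`colH G_j Lc ν (2•y − e_ν − y′) κ (Lc•(2•y) + (Lc−1)•𝟙 − e_κ − u) = colH G_j Lc ν y′ κ u`. -/
theorem colH_pointInv_ctr (hLc : Odd Lc) (j : ℕ) (y : Site (d + 1)) (ν : Fin (d + 1)) (y' : Site (d + 1)) (κ : Fin (d + 1)) (u : Site (d + 1)) :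
    colH (coDressKBmAt (toSite (ctrOff (d + 1) Lc)) Lc (KInvStep (d := d) Lc j)) Lc ν ((2 : ℕ) • y - Pi.single ν 1 - y') κ
        ((Lc : ℤ) • ((2 : ℕ) • y) + toSite (fun _ : Fin (d + 1) => Lc - 1) - Pi.single κ 1 - u)
      = colH (coDressKBmAt (toSite (ctrOff (d + 1) Lc)) Lc (KInvStep (d := d) Lc j)) Lc ν y' κ u :=
  colH_pointInv_ctr_gen hLc j ((2 : ℕ) • y) ν y' κ u

/-- NOT IN PRINT; OUR BOOKKEEPING.  **(INV-G), MULTIPLIER COLUMNS — the hypothesis `hGM` DISCHARGED with `s′ = 1`** (centred root, `Lc` odd, every `j`, label `y`, slot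
`(ν, y′)`, multiplier leg `(ρ, w)`): `colM G_j Lc ν (2•y − e_ν − y′) ρ (2•y − e_ρ − w) = colM G_j Lc ν y′ ρ w`. -/
theorem colM_pointInv_ctr (hLc : Odd Lc) (j : ℕ) (y : Site (d + 1)) (ν : Fin (d + 1)) (y' : Site (d + 1)) (ρ : Fin (d + 1)) (w : Site (d + 1)) :
    colM (coDressKBmAt (toSite (ctrOff (d + 1) Lc)) Lc (KInvStep (d := d) Lc j)) Lc ν ((2 : ℕ) • y - Pi.single ν 1 - y') ρ ((2 : ℕ) • y - Pi.single ρ 1 - w)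
      = colM (coDressKBmAt (toSite (ctrOff (d + 1) Lc)) Lc (KInvStep (d := d) Lc j)) Lc ν y' ρ w :=
  colM_pointInv_ctr_gen hLc j ((2 : ℕ) • y) ν y' ρ w

/-! ## §4 The consumer re-issued at the centred root: (INV-X-geo) modulo (INV-Z) alone -/

/-- NOT IN PRINT; OUR BOOKKEEPING.  **ROAD-P2's `weightedProfile_comb_slotInv` AT THE CENTRED ROOT, (INV-G) DISCHARGED** (`Lc` odd; `s = s′ = 1` by §3, so the one
remaining sign is `ε = t = t′` of the table-charge covariance (INV-Z), which stays DISPLAYED as `hZS ∕ hZM`): for `G_{j+1}`, `S = SpureRecAt … (j+1)`, `M = M1At … (j+1)`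
at the root `toSite (ctrOff (d+1) Lc)`, every label `y`, slot direction `ν`, channel `(a, b)`, weights `ω` (inverted slot) ∕ `ω′` (direct slot):
`V^{base}_{Z_ω}(ν, 2•y − e_ν − y′) = ε·V^{end}_{Z_ω′}(ν, y′)`. -/
theorem weightedProfile_comb_slotInv_ctr (hLc : Odd Lc) (cE cVH cΛ : ℝ) (j : ℕ) (y : Site (d + 1)) (ν : Fin (d + 1)) (a b : Fib d)
    (ω ω' : Site (d + 1) × Site (d + 1) → ℝ) (ε : ℝ)
    (hZS : ∀ (κ : Fin (d + 1)) (u : Site (d + 1)),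
      ∑' xz : Site (d + 1) × Site (d + 1), ω xz * SpureRecAt d Lc (toSite (ctrOff (d + 1) Lc)) cE cVH cΛ (j + 1) κ
          ((Lc : ℤ) • ((2 : ℕ) • y) + toSite (fun _ : Fin (d + 1) => Lc - 1) - Pi.single κ 1 - u) xz.1 xz.2 a b
        = ε * ∑' xz : Site (d + 1) × Site (d + 1), ω' xz * SpureRecAt d Lc (toSite (ctrOff (d + 1) Lc)) cE cVH cΛ (j + 1) κ u xz.1 xz.2 a b)
    (hZM : ∀ (ρ : Fin (d + 1)) (w : Site (d + 1)),
      ∑' xz : Site (d + 1) × Site (d + 1), ω xz * M1At d Lc (toSite (ctrOff (d + 1) Lc)) cΛ (j + 1) ρ ((2 : ℕ) • y - Pi.single ρ 1 - w) xz.1 xz.2 a b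
        = ε * ∑' xz : Site (d + 1) × Site (d + 1), ω' xz * M1At d Lc (toSite (ctrOff (d + 1) Lc)) cΛ (j + 1) ρ w xz.1 xz.2 a b)
    (y' : Site (d + 1)) :
    (1 / 2 : ℝ) *
        ((∑ κ : Fin (d + 1), ∑' u : Site (d + 1),
            colH (coDressKBmAt (toSite (ctrOff (d + 1) Lc)) Lc (KInvStep (d := d) Lc (j + 1))) Lc ν ((2 : ℕ) • y - Pi.single ν 1 - y') κ u
              * ((if (2 : ℕ) • y - Pi.single ν 1 - y' = y then (1 / 2 : ℝ) else 0) - (if blk Lc u = y then (1 / 2 : ℝ) else 0))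
              * ∑' xz : Site (d + 1) × Site (d + 1), ω xz * SpureRecAt d Lc (toSite (ctrOff (d + 1) Lc)) cE cVH cΛ (j + 1) κ u xz.1 xz.2 a b)
          + ∑ ρ' : Fin (d + 1), ∑' w : Site (d + 1),
            colM (coDressKBmAt (toSite (ctrOff (d + 1) Lc)) Lc (KInvStep (d := d) Lc (j + 1))) Lc ν ((2 : ℕ) • y - Pi.single ν 1 - y') ρ' w
              * ((if (2 : ℕ) • y - Pi.single ν 1 - y' = y then (1 / 2 : ℝ) else 0) - (if w = y then (1 / 2 : ℝ) else 0))
              * ∑' xz : Site (d + 1) × Site (d + 1), ω xz * M1At d Lc (toSite (ctrOff (d + 1) Lc)) cΛ (j + 1) ρ' w xz.1 xz.2 a b)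
      = ε * ((1 / 2 : ℝ) *
        ((∑ κ : Fin (d + 1), ∑' u : Site (d + 1),
            colH (coDressKBmAt (toSite (ctrOff (d + 1) Lc)) Lc (KInvStep (d := d) Lc (j + 1))) Lc ν y' κ u
              * ((if y' + Pi.single ν 1 = y then (1 / 2 : ℝ) else 0) - (if blk Lc (u + Pi.single κ 1) = y then (1 / 2 : ℝ) else 0))
              * ∑' xz : Site (d + 1) × Site (d + 1), ω' xz * SpureRecAt d Lc (toSite (ctrOff (d + 1) Lc)) cE cVH cΛ (j + 1) κ u xz.1 xz.2 a b)
          + ∑ ρ' : Fin (d + 1), ∑' w : Site (d + 1),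
            colM (coDressKBmAt (toSite (ctrOff (d + 1) Lc)) Lc (KInvStep (d := d) Lc (j + 1))) Lc ν y' ρ' w
              * ((if y' + Pi.single ν 1 = y then (1 / 2 : ℝ) else 0) - (if w + Pi.single ρ' 1 = y then (1 / 2 : ℝ) else 0))
              * ∑' xz : Site (d + 1) × Site (d + 1), ω' xz * M1At d Lc (toSite (ctrOff (d + 1) Lc)) cΛ (j + 1) ρ' w xz.1 xz.2 a b)) :=
  weightedProfile_comb_slotInv hLc.pos (toSite (ctrOff (d + 1) Lc)) cE cVH cΛ j y ν a b ω ω' (fun _ => 1) (fun _ => ε) (fun _ => 1) (fun _ => ε) ε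
    (fun _ => one_mul ε) (fun _ => one_mul ε)
    (fun y' κ u => by rw [one_mul]; exact colH_pointInv_ctr hLc (j + 1) y ν y' κ u)
    (fun y' ρ w => by rw [one_mul]; exact colM_pointInv_ctr hLc (j + 1) y ν y' ρ w) hZS hZM y'

/-- NOT IN PRINT; OUR BOOKKEEPING.  **ROAD-P2's `weightedCharge_rotatedVertex_slotInv` AT THE CENTRED ROOT, (INV-G) DISCHARGED** (`Lc` odd; (INV-Z) displayed with the
single sign `ε`): whatever value `v` the ω′-charge of the END-POINT rotated vertex `(α⁺)_y` has at the slot `(ν, y′)`, the ω-charge of `(α)_y` at the inverted slot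
`(ν, 2•y − e_ν − y′)` is `ε·v`.  (INV-X-geo) of RULING R-gan24p1-g28-1 (i) thus holds at the centred root MODULO (INV-Z) ALONE. -/
theorem weightedCharge_rotatedVertex_slotInv_ctr (hLc : Odd Lc) (cE cVH cΛ : ℝ) (j : ℕ) (y : Site (d + 1)) (ν : Fin (d + 1)) (a b : Fib d)
    {ω ω' : Site (d + 1) × Site (d + 1) → ℝ} {B : ℝ} (hω : ∀ xz, |ω xz| ≤ B) (ε : ℝ)
    (hZS : ∀ (κ : Fin (d + 1)) (u : Site (d + 1)),
      ∑' xz : Site (d + 1) × Site (d + 1), ω xz * SpureRecAt d Lc (toSite (ctrOff (d + 1) Lc)) cE cVH cΛ (j + 1) κ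
          ((Lc : ℤ) • ((2 : ℕ) • y) + toSite (fun _ : Fin (d + 1) => Lc - 1) - Pi.single κ 1 - u) xz.1 xz.2 a b
        = ε * ∑' xz : Site (d + 1) × Site (d + 1), ω' xz * SpureRecAt d Lc (toSite (ctrOff (d + 1) Lc)) cE cVH cΛ (j + 1) κ u xz.1 xz.2 a b)
    (hZM : ∀ (ρ : Fin (d + 1)) (w : Site (d + 1)),
      ∑' xz : Site (d + 1) × Site (d + 1), ω xz * M1At d Lc (toSite (ctrOff (d + 1) Lc)) cΛ (j + 1) ρ ((2 : ℕ) • y - Pi.single ρ 1 - w) xz.1 xz.2 a b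
        = ε * ∑' xz : Site (d + 1) × Site (d + 1), ω' xz * M1At d Lc (toSite (ctrOff (d + 1) Lc)) cΛ (j + 1) ρ w xz.1 xz.2 a b)
    (y' : Site (d + 1)) {B' : ℝ} (hω' : ∀ xz, |ω' xz| ≤ B') {v : ℝ}
    (hv : HasSum (fun xz : Site (d + 1) × Site (d + 1) => ω' xz *
        ((1 / 2 : ℝ) • dM (conjV (coDressKBmAt (toSite (ctrOff (d + 1) Lc)) Lc (KInvStep (d := d) Lc (j + 1))) (diagK (fun z c =>
            (((1 : ℝ) / 2) • ∑ v ∈ box (d + 1) Lc, legInd (toSite (ctrOff (d + 1) Lc)) ((Lc : ℤ) • y + toSite v))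
              (z + Sum.elim (fun κ => (Pi.single κ 1 : Site (d + 1))) (fun μ => (Lc : ℤ) • (Pi.single μ 1 : Site (d + 1))) c) c))) Lc
          (SpureRecAt d Lc (toSite (ctrOff (d + 1) Lc)) cE cVH cΛ (j + 1)) (M1At d Lc (toSite (ctrOff (d + 1) Lc)) cΛ (j + 1)) ν y') xz.1 xz.2 a b) v) :
    HasSum (fun xz : Site (d + 1) × Site (d + 1) => ω xz *
        ((1 / 2 : ℝ) • dM (conjV (coDressKBmAt (toSite (ctrOff (d + 1) Lc)) Lc (KInvStep (d := d) Lc (j + 1)))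
            (diagK (((1 : ℝ) / 2) • ∑ v ∈ box (d + 1) Lc, legInd (toSite (ctrOff (d + 1) Lc)) ((Lc : ℤ) • y + toSite v)))) Lc
          (SpureRecAt d Lc (toSite (ctrOff (d + 1) Lc)) cE cVH cΛ (j + 1)) (M1At d Lc (toSite (ctrOff (d + 1) Lc)) cΛ (j + 1)) ν
          ((2 : ℕ) • y - Pi.single ν 1 - y')) xz.1 xz.2 a b)
      (ε * v) :=
  weightedCharge_rotatedVertex_slotInv hLc.pos (ctrOff_mem_box hLc.pos) cE cVH cΛ j y ν a b hω (fun _ => 1) (fun _ => ε) (fun _ => 1) (fun _ => ε) ε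
    (fun _ => one_mul ε) (fun _ => one_mul ε)
    (fun y' κ u => by rw [one_mul]; exact colH_pointInv_ctr hLc (j + 1) y ν y' κ u)
    (fun y' ρ w => by rw [one_mul]; exact colM_pointInv_ctr hLc (j + 1) y ν y' ρ w) hZS hZM y' hω' hv

end Ctr

end Summit.QuantumFields.BalabanUV.Beta.GAN24.CoDressedColumnPointInversion

end
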